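import Summits.CriticalPhenomena.Ising3DConformalLimit.Theses.PerfectScreening
import Summits.CriticalPhenomena.Ising3DConformalLimit.Theorems.GaussianLimitNotScreened.Negative.Reformulation
import HarnessLib

/-!
# Crux `GaussianLimitNotScreened` (stmt-CriticalPhenomena-13886) — the three-regime split (crux-strategist)

THEOREM-ONLY glue for `ledger route edit route-CriticalPhenomena-PerfectScreening --split GaussianLimitNotScreened
--glue-by …gaussianLimitNotScreened_of_subs` (crux-strategist seat `planner-cstrat-stmt-CriticalPhenomena-13886-p1-0`,
2026-08-17; census `Cruxes/GaussianLimitNotScreened/STRATEGY-CENSUS.md`). After four lead seats and three dead lines the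
crux is, kernel-checked, the conjunction of its regimes in the scaling dimension `Δ ∈ [1/2, 3/4]` of a non-degenerate
Möbius-covariant Gaussian (`U₄ ≡ 0`) pointwise limit `(ρ, Δ, S)` of `criticalCorr 3`
(`GaussianLimitNotScreenedNegative.dimension_window_and_eta`, `…crux_iff_half_and_amplitude`):

* (β) `NoGaussianWindowLimit` — no such limit with `1/2 < Δ < 3/4` (there screening is automatic,
  `screened_of_half_lt`; payers on the ledger: item 2601 `GaussianLimitIsFree`, item 0636, the karamata line's
  `stub_isingCapacity` via the landed fat spread cluster);
* (γ) `NoMarginalGaussianLimit` — no such limit at the corner `Δ = 3/4` (= the registered stub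
  `stub_noMarginalGaussianLimit` of lines karamata / free-RV verbatim; payers: item 5507 `WindowBelowHalf`, item 2601,
  bridges landed p102368);
* (α) `AmplitudeAtHalf` — at `Δ = 1/2` the wave-function renormalisation `Z_m = m/ρ(1/m)²` does not tend to `0`
  (= the registered stub D `stub_amplitudeAtHalf` of line single-layer-linear-regression verbatim; payers: 13885's
  `stub_isingCapacityAxial` (p128872), item 0636, item 1343).

`gaussianLimitNotScreened_of_subs : (β) → (γ) → (α) → GaussianLimitNotScreened` is the glue (shape `C₁ → C₂ → C₃ → C`);
`gaussianLimitNotScreened_iff_subs` certifies exactness (each leaf is implied by the crux, so the split loses nothing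
and no leaf is stronger than needed). Pure logic over the landed Reformulation lemmas; no `def`s; standard axioms.
-/

noncomputable section

namespace Summit.CriticalPhenomena.Ising3DConformalLimit.PerfectScreeningGaussianLimitNotScreenedSplit

open Filter Topology
open Literature.Probability.LatticeModels
open Summit.CriticalPhenomena.Ising3DConformalLimit.GaussianLimitNotScreenedNegative
  (screened_iff_renorm dimension_window_and_eta screened_of_half_lt crux_iff_half_and_amplitude)

/-- **Glue of the three-regime split.** (β) no Gaussian Möbius limit in the open window `1/2 < Δ < 3/4`,
(γ) none at the corner `Δ = 3/4`, (α) at `Δ = 1/2` the renormalisation is canonical along a subsequence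
(`¬ ρ(1/m)²/m → ∞`) — together give `GaussianLimitNotScreened`: by the window `Δ ∈ [1/2, 3/4]` only these three
regimes occur, (β)/(γ) contradict `U₄ ≡ 0`, and at `Δ = 1/2` perfect screening is `ρ(1/m)²/m → ∞`
(`screened_iff_renorm`), which (α) forbids. [folklore] -/
theorem gaussianLimitNotScreened_of_subs :
    (∀ (ρ : ℝ → ℝ) (Δ : ℝ) (S : Literature.Probability.LatticeModels.CorrFamily 3), (∀ δ ∈ Set.Ioc (0:ℝ) 1, 0 < ρ δ) → Literature.Probability.LatticeModels.HasPointwiseScalingLimit (Literature.Probability.LatticeModels.criticalCorr 3) ρ S → Literature.Probability.LatticeModels.IsNondegenerateTwoPoint S → Literature.Probability.LatticeModels.IsMoebiusCovariant Δ S → 1 / 2 < Δ → Δ < 3 / 4 → Literature.Probability.LatticeModels.HasNontrivialU4 S) →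
    (∀ (ρ : ℝ → ℝ) (S : Literature.Probability.LatticeModels.CorrFamily 3), (∀ δ ∈ Set.Ioc (0:ℝ) 1, 0 < ρ δ) → Literature.Probability.LatticeModels.HasPointwiseScalingLimit (Literature.Probability.LatticeModels.criticalCorr 3) ρ S → Literature.Probability.LatticeModels.IsNondegenerateTwoPoint S → Literature.Probability.LatticeModels.IsMoebiusCovariant (3 / 4) S → Literature.Probability.LatticeModels.HasNontrivialU4 S) →
    (∀ (ρ : ℝ → ℝ) (S : Literature.Probability.LatticeModels.CorrFamily 3), (∀ δ ∈ Set.Ioc (0:ℝ) 1, 0 < ρ δ) → Literature.Probability.LatticeModels.HasPointwiseScalingLimit (Literature.Probability.LatticeModels.criticalCorr 3) ρ S → Literature.Probability.LatticeModels.IsNondegenerateTwoPoint S → Literature.Probability.LatticeModels.IsMoebiusCovariant (1 / 2) S → ¬ Literature.Probability.LatticeModels.HasNontrivialU4 S → ¬ Filter.Tendsto (fun m : ℕ => ρ (1 / m) ^ 2 / m) Filter.atTop Filter.atTop) →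
    Summit.CriticalPhenomena.Ising3DConformalLimit.Theses.PerfectScreening.GaussianLimitNotScreened := by
  intro hβ hγ hα ρ Δ S hρ hlim hnd hM hU4 hscr
  obtain ⟨hwin, -⟩ := dimension_window_and_eta hρ hlim hnd hM.isScaleCovariant
  rcases hwin.1.eq_or_lt with hhalf | hgt
  · -- (α): Δ = 1/2; screening is ρ(1/m)²/m → ∞, forbidden by the amplitude leaf
    subst hhalf
    exact hα ρ S hρ hlim hnd hM hU4 ((screened_iff_renorm hlim hnd).1 hscr)
  · rcases hwin.2.lt_or_eq with hlt | hcorner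
    · -- (β): open window
      exact hU4 (hβ ρ Δ S hρ hlim hnd hM hgt hlt)
    · -- (γ): the corner Δ = 3/4
      subst hcorner
      exact hU4 (hγ ρ S hρ hlim hnd hM)

/-- **Exactness of the split.** The crux is EQUIVALENT to the conjunction of its three leaves: conversely
`GaussianLimitNotScreened` forces `Δ = 1/2` for every Gaussian Möbius limit (`crux_iff_half_and_amplitude`), so a
Gaussian Möbius limit in the open window or at the corner is contradictory, and at `Δ = 1/2` it gives the amplitude
leaf verbatim. Hence no leaf is stronger than the crux requires. [folklore] -/
theorem gaussianLimitNotScreened_iff_subs :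
    Summit.CriticalPhenomena.Ising3DConformalLimit.Theses.PerfectScreening.GaussianLimitNotScreened ↔
    ((∀ (ρ : ℝ → ℝ) (Δ : ℝ) (S : Literature.Probability.LatticeModels.CorrFamily 3), (∀ δ ∈ Set.Ioc (0:ℝ) 1, 0 < ρ δ) → Literature.Probability.LatticeModels.HasPointwiseScalingLimit (Literature.Probability.LatticeModels.criticalCorr 3) ρ S → Literature.Probability.LatticeModels.IsNondegenerateTwoPoint S → Literature.Probability.LatticeModels.IsMoebiusCovariant Δ S → 1 / 2 < Δ → Δ < 3 / 4 → Literature.Probability.LatticeModels.HasNontrivialU4 S) ∧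
    (∀ (ρ : ℝ → ℝ) (S : Literature.Probability.LatticeModels.CorrFamily 3), (∀ δ ∈ Set.Ioc (0:ℝ) 1, 0 < ρ δ) → Literature.Probability.LatticeModels.HasPointwiseScalingLimit (Literature.Probability.LatticeModels.criticalCorr 3) ρ S → Literature.Probability.LatticeModels.IsNondegenerateTwoPoint S → Literature.Probability.LatticeModels.IsMoebiusCovariant (3 / 4) S → Literature.Probability.LatticeModels.HasNontrivialU4 S) ∧
    (∀ (ρ : ℝ → ℝ) (S : Literature.Probability.LatticeModels.CorrFamily 3), (∀ δ ∈ Set.Ioc (0:ℝ) 1, 0 < ρ δ) → Literature.Probability.LatticeModels.HasPointwiseScalingLimit (Literature.Probability.LatticeModels.criticalCorr 3) ρ S → Literature.Probability.LatticeModels.IsNondegenerateTwoPoint S → Literature.Probability.LatticeModels.IsMoebiusCovariant (1 / 2) S → ¬ Literature.Probability.LatticeModels.HasNontrivialU4 S → ¬ Filter.Tendsto (fun m : ℕ => ρ (1 / m) ^ 2 / m) Filter.atTop Filter.atTop)) := by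
  constructor
  · intro h
    have h' := crux_iff_half_and_amplitude.1 h
    refine ⟨?_, ?_, ?_⟩
    · intro ρ Δ S hρ hlim hnd hM hgt _
      by_contra hU4
      have hΔ := (h' ρ Δ S hρ hlim hnd hM hU4).1
      exact absurd hΔ (ne_of_gt hgt)
    · intro ρ S hρ hlim hnd hM
      by_contra hU4
      have hΔ := (h' ρ (3 / 4) S hρ hlim hnd hM hU4).1
      norm_num at hΔ
    · intro ρ S hρ hlim hnd hM hU4
      exact (h' ρ (1 / 2) S hρ hlim hnd hM hU4).2
  · rintro ⟨hβ, hγ, hα⟩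
    exact gaussianLimitNotScreened_of_subs hβ hγ hα

end Summit.CriticalPhenomena.Ising3DConformalLimit.PerfectScreeningGaussianLimitNotScreenedSplit

end
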